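import Summits.ABC.IUTFork.Thm311DHShells
import Literature.IUT.LogVolume.AdicCompletionLogShell
import HarnessLib

/-!
# [IUTchIII] Theorem 3.11 over real definitions, H: the law on the `p_v`-adic-log binder is SATISFIED by the analytic logarithms

Record-only file (D-0012) of the abc-iut cell (Cor. 3.12 sub-crew, wave-2 seat abc-iut-c312-5, board row
W2-A); TAKES NO SIDE on [IUTchIII] Cor. 3.12. THEOREMS ONLY (filed under the T1 hold on new definitions; the
named inhabitant `Real.analyticLogv := choose …` of abc-iut-L5-t5's suggestion is staged for later).
`Thm311RealDH` names the law `Real.LogvLaw logv` (`O_v ⊆ I_v = (p_v^*)⁻¹·log_v(O_v^×)` at every finite place,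
abc-iut-L6-t3's `IntegersSubsetLogShell`, [IUTchIII] Rmk. 1.2.2 (i) (b^non)) under which the Dupuy–Hilado
reading of (Ind2) is the printed one, and `Thm311DHShells` its M-level twin `Real.LogvLawVal`. abc-iut-L5-t5's
`Literature.IUT.LogVolume.AdicCompletionLogShell` (p408971; abc-iut-S1's `unitLog` computed in abc-iut-S7's
rescaled completion `RescaledCompletion F p_v v`, p408146 — the repair of the normalisation obstruction
`‖p‖_v = |p|_p^{n_v}` noted 2026-08-25) proves `IntegersSubsetLogShell (v.adicCompletionIntegers F) (log_v) p_v`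
for the ANALYTIC logarithm at every finite place. Hence, by definitional unfolding of `Real.integers` /
`Real.Carrier` / `Real.integersVal` / `Real.CarrierVal`:

* `Real.exists_logvLaw` — `∃ logv : PadicLogs F, LogvLaw logv` (with the analytic formula recorded:
  `exists_logvLaw_analytic`), so `Real.logShellsDH X logv` with a law-abiding `logv` EXISTS and for it
  `O_v ⊆ I_v` (`exists_logv_integers_subset_shell`);
* `Real.exists_logvLawVal` — the same at the M level (`PadicLogsVal K`, `LogvLawVal`).

[cite: NeukirchANT1999, Ch. II Prop. (5.5)] [claim: Mochizuki2012, status: disputed]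
typed ≠ discharged; instantiated ≠ endorsed.
-/

noncomputable section

namespace Summit.ABC.IUTFork.Thm311.Real

open NumberField IsDedekindDomain Literature.IUT.LogVolume Literature.IUT.LogThetaLattice

section FLevel

variable (F : Type) [Field F] [NumberField F]

/-- **The law `Real.LogvLaw` is satisfied by the analytic `p_v`-adic logarithms** (abc-iut-L5-t5's
`exists_logFamily_integersSubsetLogShell`): there is a family `logv : PadicLogs F` — given at each finite place by
abc-iut-S1's `unitLog` in the rescaled completion — with `O_v ⊆ I_v` everywhere.
[cite: NeukirchANT1999, Ch. II Prop. (5.5)] -/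
theorem exists_logvLaw_analytic :
    ∃ logv : PadicLogs F, LogvLaw logv ∧
      ∀ (v : HeightOneSpectrum (𝓞 F)) (u : (↥(v.adicCompletionIntegers F))ˣ),
        logv v (Additive.ofMul u) =
          (Literature.NumberTheory.NumberFields.RescaledCompletion.of F (residueChar F v) v
              (natCast_residueChar_mem F v)).symm
            (haveI : Fact (residueChar F v).Prime := ⟨residueChar_prime F v⟩
             unitLog (Literature.NumberTheory.NumberFields.RescaledCompletion.of F (residueChar F v) v
              (natCast_residueChar_mem F v) (((u : ↥(v.adicCompletionIntegers F)) : v.adicCompletion F)))) := by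
  obtain ⟨logv, h⟩ := exists_logFamily_integersSubsetLogShell F
  exact ⟨logv, fun v => (h v).2, fun v u => (h v).1 u⟩

/-- `Real.LogvLaw` is satisfiable. [claim: Mochizuki2012, status: disputed] -/
theorem exists_logvLaw : ∃ logv : PadicLogs F, LogvLaw logv :=
  let ⟨logv, h, _⟩ := exists_logvLaw_analytic F
  ⟨logv, h⟩

/-- For a law-abiding family the instantiated shells contain the integers, `O_v ⊆ I_v`, at every finite
place — so the Dupuy–Hilado Ism of `Thm311RealDH`/`Thm311DHShells` is the lattice-isomorphism group of a
genuine lattice there. [claim: Mochizuki2012, status: disputed] -/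
theorem exists_logv_integers_subset_shell :
    ∃ logv : PadicLogs F, ∀ v : HeightOneSpectrum (𝓞 F),
      ((integers v : ValuationSubring (Carrier (.inr v : Place F))) : Set (Carrier (.inr v : Place F))) ⊆
        shell logv (.inr v) :=
  let ⟨logv, h⟩ := exists_logvLaw F
  ⟨logv, fun v => integers_subset_shell_of_law h v⟩

end FLevel

section KLevel

variable (K : Type) [Field K] [NumberField K]

/-- **The M-level law `Real.LogvLawVal` is satisfied by the analytic logarithms** (same source, indexed by
`FinitePlace K` through `FinitePlace.maximalIdeal`). [cite: NeukirchANT1999, Ch. II Prop. (5.5)] -/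
theorem exists_logvLawVal : ∃ logv : PadicLogsVal K, LogvLawVal logv := by
  obtain ⟨logv, h⟩ := exists_logFamily_integersSubsetLogShell K
  exact ⟨fun w => logv (FinitePlace.maximalIdeal w), fun w => (h (FinitePlace.maximalIdeal w)).2⟩

end KLevel

end Summit.ABC.IUTFork.Thm311.Real

end

/-! ## The named analytic inhabitant (abc-iut-L5-t5's suggestion, filed from staging per abc-iut-c312-5's
close-out instruction of 2026-08-25T22:41Z — the T1 hold on new definitions has lifted): the binder
`logv` instantiated, with the law and the formula as THEOREMS about the named family. Consumers:
`Real.logShellsDH X (analyticLogv F)` is the canonical law-abiding Dupuy–Hilado instance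
(`logvLaw_analyticLogv` discharges the `hlaw` hypotheses of e.g. `Column.ind3_of_componentwise_logShellsDH`). -/

noncomputable section

namespace Summit.ABC.IUTFork.Thm311.Real

open NumberField IsDedekindDomain Literature.IUT.LogVolume Literature.IUT.LogThetaLattice

section FLevelAnalytic

variable (F : Type) [Field F] [NumberField F]

/-- **The analytic family of `p_v`-adic logarithms** `v ↦ log_v : O_v^× → K_v` (abc-iut-S1's `unitLog`
in the rescaled completion; Neukirch ANT II (5.4)–(5.5)), chosen from
`Literature.IUT.LogVolume.exists_logFamily_integersSubsetLogShell` — the intended inhabitant of the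
binder type `PadicLogs F`. [cite: NeukirchANT1999, Ch. II Prop. (5.5)] -/
def analyticLogv : PadicLogs F := (exists_logFamily_integersSubsetLogShell F).choose

/-- `analyticLogv F v` is given by the formula `u ↦ unitLog u` (in the rescaled field at `p_v`).
[cite: NeukirchANT1999, Ch. II Prop. (5.5)] -/
theorem analyticLogv_apply (v : HeightOneSpectrum (𝓞 F)) (u : (↥(v.adicCompletionIntegers F))ˣ) :
    analyticLogv F v (Additive.ofMul u) =
      (Literature.NumberTheory.NumberFields.RescaledCompletion.of F (residueChar F v) v
          (natCast_residueChar_mem F v)).symm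
        (haveI : Fact (residueChar F v).Prime := ⟨residueChar_prime F v⟩
         unitLog (Literature.NumberTheory.NumberFields.RescaledCompletion.of F (residueChar F v) v
          (natCast_residueChar_mem F v) (((u : ↥(v.adicCompletionIntegers F)) : v.adicCompletion F)))) :=
  ((exists_logFamily_integersSubsetLogShell F).choose_spec v).1 u

/-- **`Real.LogvLaw` holds for the analytic logarithms**: `O_v ⊆ I_v = (p_v^*)⁻¹ · log_v(O_v^×)` at every
finite place. [claim: Mochizuki2012, status: disputed] -/
theorem logvLaw_analyticLogv : LogvLaw (analyticLogv F) := fun v =>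
  ((exists_logFamily_integersSubsetLogShell F).choose_spec v).2

/-- `O_v ⊆ I_v` for the instantiated shells `Real.shell (analyticLogv F)` at every finite place.
[claim: Mochizuki2012, status: disputed] -/
theorem integers_subset_shell_analyticLogv (v : HeightOneSpectrum (𝓞 F)) :
    ((integers v : ValuationSubring (Carrier (.inr v : Place F))) : Set (Carrier (.inr v : Place F))) ⊆
      shell (analyticLogv F) (.inr v) :=
  integers_subset_shell_of_law (logvLaw_analyticLogv F) v

end FLevelAnalytic

section KLevelAnalytic

variable (K : Type) [Field K] [NumberField K]

/-- **The analytic family at the M level** (`PadicLogsVal K`, indexed by `FinitePlace K`).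
[cite: NeukirchANT1999, Ch. II Prop. (5.5)] -/
def analyticLogvVal : PadicLogsVal K := fun w =>
  (exists_logFamily_integersSubsetLogShell K).choose (FinitePlace.maximalIdeal w)

/-- **`Real.LogvLawVal` holds for the analytic logarithms.** [claim: Mochizuki2012, status: disputed] -/
theorem logvLawVal_analyticLogvVal : LogvLawVal (analyticLogvVal K) := fun w =>
  ((exists_logFamily_integersSubsetLogShell K).choose_spec (FinitePlace.maximalIdeal w)).2

end KLevelAnalytic

end Summit.ABC.IUTFork.Thm311.Real

end
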